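import Literature.Analysis.FunctionSpaces.TorusMollifier
import Mathlib.Analysis.SpecialFunctions.JapaneseBracket
import Mathlib.MeasureTheory.Measure.Haar.NormedSpace
import HarnessLib

/-!
# Kernel moments on `𝕋^d` at a small scale `ε`: the weighted Cauchy–Schwarz reduction to even moments, and the
# Euclidean weight integral `∫ ‖reprc z‖⁶ (ε² + ‖reprc z‖²)^{−s} dz ≤ ε^{6+d−2s}·I_{d,s}`

Analysis/FunctionSpaces support file (everything proved; no definitions, no named facts).  Second layer of the
kernel-moment bound `∫ ‖reprc z‖³ |K(z)| dz ≲ ε²` for a trigonometric polynomial `K` whose coefficients vary on the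
frequency scale `1/ε` (`TorusTrigPolyDifferences` converts even moments `∫‖reprc‖^{2i}|K|²` into discrete
differences of the coefficients):

* `integral_cube_moment_le_sqrt_mul_sqrt` — Cauchy–Schwarz with the weight `W = (ε² + ‖reprc z‖²)^s`:
  `∫ ‖reprc z‖³ ‖K z‖ ≤ √(∫ ‖reprc z‖⁶/W) · √(∫ W ‖K z‖²)`;
* `integral_weight_mul_norm_sq_eq_sum` — `∫ W‖K‖² = Σ_{i≤s} C(s,i) ε^{2(s−i)} ∫ ‖reprc z‖^{2i}‖K z‖²` (binomial);
* `integral_norm_reprc_six_div_weight_le` — `∫_𝕋 ‖reprc z‖⁶/(ε²+‖reprc z‖²)^s ≤ ε⁶·ε^d/ε^{2s} · ∫_{ℝ^d} ‖u‖⁶/(1+‖u‖²)^s`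
  for `d + 6 < 2s` (unfold to the centred cube by `measurePreserving_reprc`, enlarge to `ℝ^d`, rescale `u = v/ε`;
  the Euclidean integral is finite by comparison with `(1+‖u‖)^{−2(s−3)}`, `integrable_one_add_norm`).

Together: `∫‖reprc‖³|K| ≤ ε^{(6+d−2s)/2} √I · √(Σ_i C(s,i) ε^{2(s−i)} (d^{i−1}/16^i) Σ_jΣ_k |D_j^i c(k)|²)`, and for
coefficients `c(k) = (2πi k_a/ε)·H(εk)`-type (`|D_j^i c| ≲ ε^{i−1}`, support `≍ ε^{−d}` points) every summand is
`≍ ε^{2s−2−d}`, whence `∫‖reprc‖³|K| ≲ ε²` (Grafakos 2014, Prop. 3.2.7 (3) / §3.3: smoothness of the symbol ↔ decay of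
the kernel, here in quantitative finite form).

Consumer: cell `ad-ideate`, K1L_D `stmt-AnomalousDissipation-27980`, W3-E (i) (re-plan P2b; crux memo
`Lines/onelevel-W3E-k3l-lyapunov.md`).

## Mathlib / tree search
Mathlib: `integral_mul_le_Lp_mul_Lq_of_nonneg` (Hölder `p = q = 2`), `add_pow`, `Measure.integral_comp_smul`,
`integrable_one_add_norm`, `setIntegral_le_integral`.  Tree: `TorusMollifier` (`reprc`, `integral_comp_reprc`,
`measurable_reprc`, `abs_reprc_apply_le`); the even moments feed in from `TorusTrigPolyDifferences`.

## References
* L. Grafakos, *Classical Fourier Analysis*, 3rd ed. (2014), Prop. 3.2.7 (3), §3.3.1. [`Grafakos2014`]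
-/

noncomputable section

open MeasureTheory Set Filter UnitAddTorus Function
open scoped ENNReal

namespace Literature.Analysis.FunctionSpaces

namespace Torus

variable {d : Type*} [Fintype d]
variable {V : Type*} [NormedAddCommGroup V]

/-! ## §1 Weighted Cauchy–Schwarz -/

/-- `‖reprc z‖ ≤ card d` (file-local). [folklore] -/
private theorem norm_reprc_le_card' (z : UnitAddTorus d) : ‖reprc z‖ ≤ Fintype.card d := by
  rw [EuclideanSpace.norm_eq]
  have h1 : ∑ i, ‖reprc z i‖ ^ 2 ≤ ∑ _i : d, (1 : ℝ) := Finset.sum_le_sum fun i _ => by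
    rw [Real.norm_eq_abs]
    have := abs_reprc_apply_le z i
    nlinarith [abs_nonneg (reprc z i)]
  rw [Finset.sum_const, Finset.card_univ, nsmul_eq_mul, mul_one] at h1
  calc Real.sqrt (∑ i, ‖reprc z i‖ ^ 2) ≤ Real.sqrt (Fintype.card d) := Real.sqrt_le_sqrt h1
    _ ≤ Fintype.card d := by
        rcases Nat.eq_zero_or_pos (Fintype.card d) with h | h
        · simp [h]
        · have h1 : (1:ℝ) ≤ Fintype.card d := by exact_mod_cast h
          rw [Real.sqrt_le_left (by linarith)]
          nlinarith

/-- **Cauchy–Schwarz with the weight `(ε² + ‖reprc z‖²)^s`**: for `K` continuous,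
`∫ ‖reprc z‖³ ‖K z‖ ≤ √(∫ ‖reprc z‖⁶ / (ε²+‖reprc z‖²)^s) · √(∫ (ε²+‖reprc z‖²)^s ‖K z‖²)`.
[cite: Grafakos2014, Prop. 3.2.7 (3)] -/
theorem integral_cube_moment_le_sqrt_mul_sqrt {K : UnitAddTorus d → V} (hK : Continuous K) {ε : ℝ} (hε : 0 < ε)
    (s : ℕ) :
    ∫ z : UnitAddTorus d, ‖reprc z‖ ^ 3 * ‖K z‖ ≤
      Real.sqrt (∫ z : UnitAddTorus d, ‖reprc z‖ ^ 6 / (ε ^ 2 + ‖reprc z‖ ^ 2) ^ s) *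
        Real.sqrt (∫ z : UnitAddTorus d, (ε ^ 2 + ‖reprc z‖ ^ 2) ^ s * ‖K z‖ ^ 2) := by
  set ρ : UnitAddTorus d → ℝ := fun z => ‖reprc z‖ with hρ
  set W : UnitAddTorus d → ℝ := fun z => (ε ^ 2 + ρ z ^ 2) ^ s with hW
  have hW0 : ∀ z, 0 < W z := fun z => by rw [hW]; exact pow_pos (by positivity) s
  set f : UnitAddTorus d → ℝ := fun z => ρ z ^ 3 / Real.sqrt (W z) with hf
  set g : UnitAddTorus d → ℝ := fun z => Real.sqrt (W z) * ‖K z‖ with hg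
  have hρm : Measurable ρ := measurable_reprc.norm
  have hWm : Measurable W := (measurable_const.add (hρm.pow_const 2)).pow_const s
  have hfm : AEStronglyMeasurable f volume := ((hρm.pow_const 3).div (hWm.sqrt)).aestronglyMeasurable
  have hgm : AEStronglyMeasurable g volume := (hWm.sqrt.mul hK.norm.measurable).aestronglyMeasurable
  -- bounds (everything is bounded on the compact torus)
  obtain ⟨CK, hCK⟩ := (isCompact_univ.image hK).isBounded.exists_norm_le
  have hρle : ∀ z, ρ z ≤ Fintype.card d := fun z => norm_reprc_le_card' z
  have hρ0 : ∀ z, 0 ≤ ρ z := fun z => norm_nonneg _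
  have hWle : ∀ z, W z ≤ (ε ^ 2 + (Fintype.card d : ℝ) ^ 2) ^ s := fun z =>
    pow_le_pow_left₀ (by positivity) (by nlinarith [hρle z, hρ0 z]) s
  have hf_bound : ∀ z, ‖f z‖ ≤ (Fintype.card d : ℝ) ^ 3 / Real.sqrt (ε ^ (2 * s)) := by
    intro z
    rw [hf, Real.norm_eq_abs, abs_div, abs_of_nonneg (pow_nonneg (hρ0 z) 3), abs_of_nonneg (Real.sqrt_nonneg _)]
    have hWge : ε ^ (2 * s) ≤ W z := by
      rw [hW, pow_mul]; exact pow_le_pow_left₀ (by positivity) (by nlinarith [hρ0 z]) s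
    have hsq : Real.sqrt (ε ^ (2 * s)) ≤ Real.sqrt (W z) := Real.sqrt_le_sqrt hWge
    have hsq0 : 0 < Real.sqrt (ε ^ (2 * s)) := Real.sqrt_pos.2 (by positivity)
    exact div_le_div₀ (by positivity) (pow_le_pow_left₀ (hρ0 z) (hρle z) 3) hsq0 hsq
  have hg_bound : ∀ z, ‖g z‖ ≤ Real.sqrt ((ε ^ 2 + (Fintype.card d : ℝ) ^ 2) ^ s) * CK := by
    intro z
    rw [hg, Real.norm_eq_abs, abs_mul, abs_of_nonneg (Real.sqrt_nonneg _), abs_norm]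
    exact mul_le_mul (Real.sqrt_le_sqrt (hWle z)) (hCK _ ⟨z, Set.mem_univ _, rfl⟩) (norm_nonneg _)
      (Real.sqrt_nonneg _)
  have hf2 : MemLp f (ENNReal.ofReal 2) volume := by
    rw [show ENNReal.ofReal 2 = 2 by norm_num]
    exact MemLp.of_bound hfm _ (ae_of_all _ hf_bound)
  have hg2 : MemLp g (ENNReal.ofReal 2) volume := by
    rw [show ENNReal.ofReal 2 = 2 by norm_num]
    exact MemLp.of_bound hgm _ (ae_of_all _ hg_bound)
  have hCS := integral_mul_le_Lp_mul_Lq_of_nonneg (μ := (volume : Measure (UnitAddTorus d))) Real.HolderConjugate.two_two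
    (ae_of_all _ fun z => by rw [hf]; exact div_nonneg (pow_nonneg (hρ0 z) 3) (Real.sqrt_nonneg _))
    (ae_of_all _ fun z => by rw [hg]; exact mul_nonneg (Real.sqrt_nonneg _) (norm_nonneg _)) hf2 hg2
  -- identify the three integrands
  have hfg : ∀ z, f z * g z = ρ z ^ 3 * ‖K z‖ := by
    intro z
    rw [hf, hg]
    have hs0 : Real.sqrt (W z) ≠ 0 := (Real.sqrt_pos.2 (hW0 z)).ne'
    field_simp
  have hff : ∀ z, f z ^ (2:ℝ) = ρ z ^ 6 / W z := by
    intro z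
    rw [Real.rpow_two, hf]
    simp only
    rw [div_pow, Real.sq_sqrt (hW0 z).le]
    ring
  have hgg : ∀ z, g z ^ (2:ℝ) = W z * ‖K z‖ ^ 2 := by
    intro z
    rw [Real.rpow_two, hg]
    simp only
    rw [mul_pow, Real.sq_sqrt (hW0 z).le]
  simp_rw [hfg, hff, hgg] at hCS
  rw [Real.sqrt_eq_rpow, Real.sqrt_eq_rpow]
  simpa only [one_div] using hCS

/-! ## §2 The binomial expansion of the weight -/

/-- **`∫ (ε² + ‖reprc z‖²)^s ‖K z‖² = Σ_{i≤s} C(s,i) ε^{2(s−i)} ∫ ‖reprc z‖^{2i} ‖K z‖²`** (`K` continuous).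
[cite: Grafakos2014, Prop. 3.2.7 (3)] -/
theorem integral_weight_mul_norm_sq_eq_sum {K : UnitAddTorus d → V} (hK : Continuous K) (ε : ℝ) (s : ℕ) :
    ∫ z : UnitAddTorus d, (ε ^ 2 + ‖reprc z‖ ^ 2) ^ s * ‖K z‖ ^ 2 =
      ∑ i ∈ Finset.range (s + 1), (s.choose i : ℝ) * ε ^ (2 * (s - i)) * ∫ z : UnitAddTorus d, ‖reprc z‖ ^ (2 * i) * ‖K z‖ ^ 2 := by
  obtain ⟨CK, hCK⟩ := (isCompact_univ.image hK).isBounded.exists_norm_le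
  have hint : ∀ i : ℕ, Integrable (fun z : UnitAddTorus d => ‖reprc z‖ ^ (2 * i) * ‖K z‖ ^ 2) volume := by
    intro i
    have hm : AEStronglyMeasurable (fun z : UnitAddTorus d => ‖reprc z‖ ^ (2 * i) * ‖K z‖ ^ 2) volume :=
      ((measurable_reprc.norm.pow_const _).mul (hK.norm.measurable.pow_const 2)).aestronglyMeasurable
    refine Integrable.of_bound hm ((Fintype.card d : ℝ) ^ (2 * i) * CK ^ 2) (ae_of_all _ fun z => ?_)
    rw [Real.norm_eq_abs, abs_mul, abs_of_nonneg (pow_nonneg (norm_nonneg _) _), abs_of_nonneg (sq_nonneg _)]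
    exact mul_le_mul (pow_le_pow_left₀ (norm_nonneg _) (norm_reprc_le_card' z) _)
      (pow_le_pow_left₀ (norm_nonneg _) (hCK _ ⟨z, Set.mem_univ _, rfl⟩) 2) (sq_nonneg _) (by positivity)
  have hpt : ∀ z : UnitAddTorus d, (ε ^ 2 + ‖reprc z‖ ^ 2) ^ s * ‖K z‖ ^ 2 =
      ∑ i ∈ Finset.range (s + 1), (s.choose i : ℝ) * ε ^ (2 * (s - i)) * (‖reprc z‖ ^ (2 * i) * ‖K z‖ ^ 2) := by
    intro z
    rw [add_comm, add_pow, Finset.sum_mul]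
    refine Finset.sum_congr rfl fun i _ => ?_
    rw [← pow_mul, ← pow_mul, mul_comm 2 i]
    ring
  simp_rw [hpt]
  rw [integral_finsetSum _ fun i _ => (hint i).const_mul _]
  refine Finset.sum_congr rfl fun i _ => ?_
  rw [integral_const_mul]

/-! ## §3 The Euclidean weight integral -/

/-- The Euclidean weight `u ↦ ‖u‖⁶/(1+‖u‖²)^s` is integrable on `ℝ^d` when `d + 6 < 2s` (comparison with
`(1+‖u‖)^{−2(s−3)}`). [cite: Grafakos2014, §3.3.1] -/
theorem integrable_norm_six_div_one_add_sq_pow (s : ℕ) (hs : (Fintype.card d : ℝ) + 6 < 2 * s) :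
    Integrable (fun u : EuclideanSpace ℝ d => ‖u‖ ^ 6 / (1 + ‖u‖ ^ 2) ^ s) volume := by
  have h3s : 3 < s := by
    have : ((3:ℕ) : ℝ) < s := by push_cast; linarith [Nat.cast_nonneg (α := ℝ) (Fintype.card d)]
    exact_mod_cast this
  set m : ℕ := s - 3 with hm
  have hsm : s = m + 3 := by omega
  have hr : (Module.finrank ℝ (EuclideanSpace ℝ d) : ℝ) < ((2 * m : ℕ) : ℝ) := by
    rw [finrank_euclideanSpace]
    push_cast
    have : (s:ℝ) = m + 3 := by rw [hsm]; push_cast; ring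
    linarith
  have hI := integrable_one_add_norm (E := EuclideanSpace ℝ d) (μ := volume) hr
  refine Integrable.mono' (hI.const_mul ((2:ℝ) ^ m)) ?_ (ae_of_all _ fun u => ?_)
  · exact ((continuous_norm.pow 6).div ((continuous_const.add (continuous_norm.pow 2)).pow s)
      fun u => (pow_pos (add_pos_of_pos_of_nonneg one_pos (sq_nonneg ‖u‖)) s).ne').aestronglyMeasurable
  · have hu : 0 ≤ ‖u‖ := norm_nonneg u
    have hB : 0 < (1 + ‖u‖) ^ (2 * m) := pow_pos (by positivity) _
    have h12 : 0 < 1 + ‖u‖ ^ 2 := by positivity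
    rw [Real.norm_eq_abs, abs_of_nonneg (div_nonneg (pow_nonneg hu 6) (pow_nonneg h12.le s)), hsm,
      pow_add, Real.rpow_neg (by positivity), Real.rpow_natCast]
    have h1 : ‖u‖ ^ 6 ≤ (1 + ‖u‖ ^ 2) ^ 3 := by nlinarith [pow_nonneg hu 2, pow_nonneg hu 4, pow_nonneg hu 6]
    have h2 : (1 + ‖u‖) ^ 2 ≤ 2 * (1 + ‖u‖ ^ 2) := by nlinarith [sq_nonneg (1 - ‖u‖)]
    have h3 : (1 + ‖u‖) ^ (2 * m) ≤ 2 ^ m * (1 + ‖u‖ ^ 2) ^ m := by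
      rw [pow_mul, ← mul_pow]; exact pow_le_pow_left₀ (sq_nonneg _) h2 m
    have key : ‖u‖ ^ 6 * (1 + ‖u‖) ^ (2 * m) ≤ 2 ^ m * (1 + ‖u‖ ^ 2) ^ m * (1 + ‖u‖ ^ 2) ^ 3 := by
      calc ‖u‖ ^ 6 * (1 + ‖u‖) ^ (2 * m) ≤ (1 + ‖u‖ ^ 2) ^ 3 * (2 ^ m * (1 + ‖u‖ ^ 2) ^ m) :=
            mul_le_mul h1 h3 hB.le (by positivity)
        _ = 2 ^ m * (1 + ‖u‖ ^ 2) ^ m * (1 + ‖u‖ ^ 2) ^ 3 := by ring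
    rw [div_le_iff₀ (mul_pos (pow_pos h12 m) (pow_pos h12 3))]
    calc ‖u‖ ^ 6 = ‖u‖ ^ 6 * (1 + ‖u‖) ^ (2 * m) * ((1 + ‖u‖) ^ (2 * m))⁻¹ := by
          rw [mul_inv_cancel_right₀ hB.ne']
      _ ≤ (2 ^ m * (1 + ‖u‖ ^ 2) ^ m * (1 + ‖u‖ ^ 2) ^ 3) * ((1 + ‖u‖) ^ (2 * m))⁻¹ :=
          mul_le_mul_of_nonneg_right key (by positivity)
      _ = 2 ^ m * ((1 + ‖u‖) ^ (2 * m))⁻¹ * ((1 + ‖u‖ ^ 2) ^ m * (1 + ‖u‖ ^ 2) ^ 3) := by ring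

/-- **The torus weight integral is below its Euclidean rescaling**: for `0 < ε` and `d + 6 < 2s`,
`∫_𝕋 ‖reprc z‖⁶/(ε² + ‖reprc z‖²)^s dz ≤ (ε⁶ ε^d / ε^{2s}) · ∫_{ℝ^d} ‖u‖⁶/(1 + ‖u‖²)^s du`
(unfold to the centred cube, enlarge to `ℝ^d`, rescale `u = v/ε`). [cite: Grafakos2014, §3.3.1] -/
theorem integral_norm_reprc_six_div_weight_le {ε : ℝ} (hε : 0 < ε) (s : ℕ) (hs : (Fintype.card d : ℝ) + 6 < 2 * s) :
    ∫ z : UnitAddTorus d, ‖reprc z‖ ^ 6 / (ε ^ 2 + ‖reprc z‖ ^ 2) ^ s ≤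
      (ε ^ 6 * ε ^ Fintype.card d / ε ^ (2 * s)) *
        ∫ u : EuclideanSpace ℝ d, ‖u‖ ^ 6 / (1 + ‖u‖ ^ 2) ^ s := by
  set g : EuclideanSpace ℝ d → ℝ := fun u => ‖u‖ ^ 6 / (1 + ‖u‖ ^ 2) ^ s with hg
  set h : EuclideanSpace ℝ d → ℝ := fun v => ‖v‖ ^ 6 / (ε ^ 2 + ‖v‖ ^ 2) ^ s with hh
  have hgi : Integrable g volume := integrable_norm_six_div_one_add_sq_pow s hs
  -- `h = (ε⁶/ε^{2s}) · g (ε⁻¹ • ·)`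
  have hscale : ∀ v : EuclideanSpace ℝ d, h v = ε ^ 6 / ε ^ (2 * s) * g (ε⁻¹ • v) := by
    intro v
    rw [hh, hg]
    simp only
    rw [norm_smul, norm_inv, Real.norm_eq_abs, abs_of_pos hε]
    have hε0 : ε ≠ 0 := hε.ne'
    have hq : (0:ℝ) < ε ^ 2 + ‖v‖ ^ 2 := by positivity
    have e1 : (1 + (ε⁻¹ * ‖v‖) ^ 2) ^ s = (ε ^ 2 + ‖v‖ ^ 2) ^ s / ε ^ (2 * s) := by
      rw [pow_mul, ← div_pow]
      congr 1
      field_simp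
    rw [e1, mul_pow, inv_pow]
    field_simp
  have hhi : Integrable h volume := by
    have := (hgi.comp_smul (inv_ne_zero hε.ne')).const_mul (ε ^ 6 / ε ^ (2 * s))
    refine this.congr (ae_of_all _ fun v => ?_)
    simp only
    rw [hscale]
  have hh0 : ∀ v, 0 ≤ h v := fun v => by rw [hh]; exact div_nonneg (pow_nonneg (norm_nonneg _) 6) (pow_nonneg (by positivity) s)
  calc ∫ z : UnitAddTorus d, ‖reprc z‖ ^ 6 / (ε ^ 2 + ‖reprc z‖ ^ 2) ^ s
      = ∫ v in centredCube d, h v := integral_comp_reprc h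
    _ ≤ ∫ v, h v := setIntegral_le_integral hhi (ae_of_all _ hh0)
    _ = ∫ v, ε ^ 6 / ε ^ (2 * s) * g (ε⁻¹ • v) := integral_congr_ae (ae_of_all _ hscale)
    _ = ε ^ 6 / ε ^ (2 * s) * (|((ε⁻¹) ^ Module.finrank ℝ (EuclideanSpace ℝ d))⁻¹| * ∫ u, g u) := by
        rw [integral_const_mul, Measure.integral_comp_smul]
        rfl
    _ = (ε ^ 6 * ε ^ Fintype.card d / ε ^ (2 * s)) * ∫ u : EuclideanSpace ℝ d, ‖u‖ ^ 6 / (1 + ‖u‖ ^ 2) ^ s := by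
        rw [finrank_euclideanSpace, inv_pow, inv_inv, abs_of_pos (pow_pos hε _)]
        ring

end Torus

end Literature.Analysis.FunctionSpaces

end
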